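import Mathlib
import Summits.Ventures.HodgeRepro.Tier4.Line1.IsotypicHeckeAlgebra
import Summits.Ventures.HodgeRepro.Tier4.Line1.IsotypicBernsteinIso
import Summits.Ventures.HodgeRepro.Tier4.Line1.HeckeFiniteness
import Summits.Ventures.HodgeRepro.Tier4.Line1.HeckeBlockIdempotent

/-!
# Tier4/Line1/SphericalHeckeAlgebra — THE SPHERICAL CASE `σ = 1` OF THE HECKE ALGEBRA OF TYPE σ: `eσ` of the trivial
type is `indK`, the type-`1` block is the spherical block, the spherical Hecke algebra `C_c(K\G/K)` is
`HeckeAlg S K 1`, acting on `sphericalBlock S K`; `hact` / `hfull` THEOREMS; (C1) and (C2) for the spherical block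

Blind re-derivation cell `pub-hodge-repro`, Tier 4 (README §9–§10), seat t4-L1-p2 (gen 4), LINE L1; the cut
(C0-HECKE) as RE-POINTED by t4-plan-1 g2 (S14289 (3): the spherical case is the `σ = 1` case of t4-L1-p3 g3's
`IsotypicHeckeAlgebra`, the object of record for row (6)).  Target tree path
`lean/Summits/Ventures/HodgeRepro/Tier4/Line1/SphericalHeckeAlgebra.lean`.  Imports t4-L1-p3's
`IsotypicHeckeAlgebra` (`HeckeAlg`, its `Ring` / `Algebra ℂ` instances, `heckeElt_mem`, `mem_heckeAlg`,
`R_add_fun`, `R_zero_fun`) and through it `IsotypicIdempotent` (`eσ`, `repExt`, `charExt`, `IsUnitaryRep`,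
`IsIrreducibleRep`) and `IsotypicBlock` (`isotypicFixed`, `mem_isotypicFixed`), this seat's `IsotypicBernsteinIso`
(`hnon_of_multiplicityOne_core`) and `BlockSimple` (`isSimpleModule_of_block`, `R_R_eq_R_conv_conv`) through it,
t4-L1-p1's `HeckeFiniteness` (`R_mul_right_of_left_invariant`), t4-L1-p5's `HeckeBlockSpherical`
(`sphericalBlock`, `indK`, `isTest_indK`, `indK_left_invariant`, `indK_right_invariant`, `integral_indK`,
`R_indK_of_right_invariant`, `inner_R_indK_adj`, `finiteDimensional_sphericalBlock`,
`continuous_of_mem_sphericalBlock`) and `HeckeBlockIdempotent` (`mem_sphericalBlock_iff_fixed`).  0 print.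

WHAT IS PROVED.  `trivialRep K := (1 : K →* Matrix (Fin 1) (Fin 1) ℂ)`; **`eσ_trivialRep : eσ S K (trivialRep K)
= indK S K`** ON THE NOSE (`d = 1`, `charExt K 1 = 1_K`, `conj 1 = 1`; the normalisations `d · μ(K)⁻¹ · conj χ` and
`μ(K)⁻¹ · 1_K` agree, no scalar); `isUnitaryRep_trivialRep`, `continuous_trivialRep`, `isIrreducibleRep_trivialRep`
(`finrank ℂ (Fin 1 → ℂ) = 1`); **`isotypicFixed_trivialRep : isotypicFixed S K (trivialRep K) hKo hKc _ =
sphericalBlock S K`** (p5's `mem_sphericalBlock_iff_fixed`).  `SphericalHecke S K hKo hKc := HeckeAlg S K (trivialRep K)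
hKo hKc _ _` (an `abbrev`, so p3's ring and algebra structures apply), with **`mem_sphericalHecke_iff : t ∈
SphericalHecke ↔ IsTest t ∧ (∀ k ∈ K, ∀ g, t (k * g) = t g) ∧ ∀ g, ∀ k ∈ K, t (g * k) = t g`** (`= C_c(K\G/K)`:
`conv_indK_left/right`, `conv_left/right_invariant`).  The MODULE structure on p5's block type `sphericalBlock S K`
by `r • ψ := R (r) ψ` (`one_smul` = `R_indK_of_right_invariant`, `mul_smul` = `R_R_eq_R_conv`, `smul_add` = `R_add'`,
`add_smul` = p3's `R_add_fun`), `IsScalarTower ℂ` (`R_smul_left`); `hact` is `rfl` (`smul_coe`); **`hfull_spherical`**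
(`r := indK ⋆ f ⋆ indK`, p3's `heckeElt_mem` at `σ = 1`, `R_R_eq_R_conv_conv`).  CONSUMERS: **`isSimpleModule_spherical`**
— (C1) for the spherical block: a constituent `Wi = τ m' ∩ sphericalBlock` of an invariant irreducible `τ m'` with a
non-zero vector is a simple `SphericalHecke`-module; displayed `hinv`, `hirr`, `hWi`, `hne` only.
**`hnon_spherical_of_multiplicityOne_core`** — (C2): the constituents of the block are pairwise non-isomorphic
`SphericalHecke`-modules from MULTIPLICITY ONE OF THE ALGEBRAIC CORES (DATA, displayed); `hfull` / `hact` / `htstK`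
are theorems.  For p5's `HeckeBlockW.spherical` instantiate `H := SphericalHecke S K hKo hKc`, `tst := Subtype.val`,
`htst := sphericalHecke_isTest`, `htstK := sphericalHecke_right_invariant`, `hact := smul_coe`.

NOT claimed: the projections `π` / `hπsum` (C-PROJ), (C3), closures.  Nothing here says anything about the status
of the Hodge conjecture for CM abelian varieties, which is NOT proved (HC_CM is NOT proved by anyone in this
repository).
-/

set_option autoImplicit false

noncomputable section

namespace Summit.Ventures.HodgeRepro.Tier4.Line1

open MeasureTheory Topology

namespace RTF

namespace Setting

variable {G : Type} [Group G] [TopologicalSpace G] [IsTopologicalGroup G] [MeasurableSpace G] [BorelSpace G]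
  (S : Setting G) (K : Subgroup G)

section Trivial

omit [TopologicalSpace G] [IsTopologicalGroup G] [MeasurableSpace G] [BorelSpace G] in
/-- the trivial one-dimensional representation of `K`. -/
def trivialRep : K →* Matrix (Fin 1) (Fin 1) ℂ := 1

omit [TopologicalSpace G] [IsTopologicalGroup G] [MeasurableSpace G] [BorelSpace G] in
/-- the trivial representation is `1` on every element. -/
theorem trivialRep_apply (k : K) : trivialRep K k = 1 := rfl

omit [TopologicalSpace G] [IsTopologicalGroup G] [MeasurableSpace G] [BorelSpace G] in
/-- the character of the trivial type is the indicator of `K`. -/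
theorem charExt_trivialRep (g : G) : charExt K (trivialRep K) g = (K : Set G).indicator (fun _ => (1 : ℂ)) g := by
  by_cases hg : g ∈ K
  · rw [charExt, repExt_of_mem K (trivialRep K) hg, trivialRep_apply, Matrix.trace_one, Set.indicator_of_mem hg]
    simp
  · rw [charExt, repExt_of_not_mem K (trivialRep K) hg, Matrix.trace_zero, Set.indicator_of_notMem hg]

omit [IsTopologicalGroup G] [BorelSpace G] in
/-- **`eσ` of the trivial type is `indK`** (on the nose: `d = 1`, `conj 1 = 1`). -/
theorem eσ_trivialRep : eσ S K (trivialRep K) = indK S K := by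
  funext g
  rw [eσ, charExt_trivialRep, indK]
  by_cases hg : g ∈ K
  · rw [Set.indicator_of_mem hg, Set.indicator_of_mem hg]
    simp
  · rw [Set.indicator_of_notMem hg, Set.indicator_of_notMem hg]
    simp

omit [TopologicalSpace G] [IsTopologicalGroup G] [MeasurableSpace G] [BorelSpace G] in
/-- the trivial representation is unitary. -/
theorem isUnitaryRep_trivialRep : IsUnitaryRep (trivialRep K) :=
  ⟨fun k => by rw [trivialRep_apply, Matrix.conjTranspose_one, one_mul]⟩

omit [IsTopologicalGroup G] [MeasurableSpace G] [BorelSpace G] in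
/-- the trivial representation is continuous. -/
theorem continuous_trivialRep : Continuous (trivialRep K) := continuous_const

omit [TopologicalSpace G] [IsTopologicalGroup G] [MeasurableSpace G] [BorelSpace G] in
/-- the trivial representation is irreducible (`ℂ^1` has no proper non-zero subspace). -/
theorem isIrreducibleRep_trivialRep : IsIrreducibleRep (trivialRep K) := by
  refine ⟨fun U _ => ?_⟩
  haveI : IsSimpleModule ℂ (Fin 1 → ℂ) := (isSimpleModule_iff_finrank_eq_one).2 (by simp)
  exact eq_bot_or_eq_top U

variable (hKo : IsOpen (K : Set G)) (hKc : IsCompact (K : Set G))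

/-- **the type-`1` block is the spherical block**. -/
theorem isotypicFixed_trivialRep [MeasurableMul G] :
    isotypicFixed S K (trivialRep K) hKo hKc (continuous_trivialRep K) = sphericalBlock S K := by
  ext ψ
  rw [mem_isotypicFixed, eσ_trivialRep, S.mem_sphericalBlock_iff_fixed K hKo hKc]

end Trivial

section ConvInvariance

omit [IsTopologicalGroup G] [BorelSpace G] in
/-- the convolution of two functions the first of which is left-`K`-invariant is left-`K`-invariant. -/
theorem conv_left_invariant [MeasurableMul G] {f₁ f₂ : G → ℂ} (h₁ : ∀ k ∈ K, ∀ g, f₁ (k * g) = f₁ g) :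
    ∀ k ∈ K, ∀ g, S.conv f₁ f₂ (k * g) = S.conv f₁ f₂ g := by
  intro k hk g
  haveI := S.haar
  unfold conv
  have hsub := integral_mul_left_eq_self (μ := S.μ) (fun h => f₁ h * f₂ (h⁻¹ * (k * g))) k
  rw [← hsub]
  congr 1
  funext h
  rw [h₁ k hk h, mul_inv_rev, mul_assoc, inv_mul_cancel_left]

omit [IsTopologicalGroup G] [BorelSpace G] in
/-- the convolution of two functions the second of which is right-`K`-invariant is right-`K`-invariant. -/
theorem conv_right_invariant {f₁ f₂ : G → ℂ} (h₂ : ∀ g, ∀ k ∈ K, f₂ (g * k) = f₂ g) :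
    ∀ g, ∀ k ∈ K, S.conv f₁ f₂ (g * k) = S.conv f₁ f₂ g := by
  intro g k hk
  unfold conv
  congr 1
  funext h
  rw [← mul_assoc, h₂ _ k hk]

omit [IsTopologicalGroup G] [BorelSpace G] in
/-- `indK` is inversion-invariant. -/
theorem indK_inv (g : G) : indK S K g⁻¹ = indK S K g := by
  by_cases hg : g ∈ K
  · rw [S.indK_of_mem K (K.inv_mem hg), S.indK_of_mem K hg]
  · rw [S.indK_of_not_mem K (fun h => hg (by simpa using K.inv_mem h)), S.indK_of_not_mem K hg]

omit [IsTopologicalGroup G] in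
/-- **`indK ⋆ f = f` for a left-`K`-invariant `f`**. -/
theorem conv_indK_left (hKo : IsOpen (K : Set G)) (hKc : IsCompact (K : Set G)) {f : G → ℂ}
    (hf : ∀ k ∈ K, ∀ g, f (k * g) = f g) : S.conv (indK S K) f = f := by
  funext x
  unfold conv
  have h : (fun h => indK S K h * f (h⁻¹ * x)) = fun h => indK S K h * f x := by
    funext h
    by_cases hh : h ∈ K
    · rw [hf h⁻¹ (K.inv_mem hh) x]
    · rw [S.indK_of_not_mem K hh, zero_mul, zero_mul]
  rw [h, integral_mul_const, S.integral_indK K hKo hKc, one_mul]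

omit [IsTopologicalGroup G] in
/-- **`f ⋆ indK = f` for a right-`K`-invariant `f`**. -/
theorem conv_indK_right [MeasurableMul G] (hKo : IsOpen (K : Set G)) (hKc : IsCompact (K : Set G)) {f : G → ℂ}
    (hf : ∀ g, ∀ k ∈ K, f (g * k) = f g) : S.conv f (indK S K) = f := by
  haveI := S.haar
  funext x
  unfold conv
  have h1 : (fun h => f h * indK S K (h⁻¹ * x)) = fun h => f h * indK S K (x⁻¹ * h) := by
    funext h
    rw [← S.indK_inv K (h⁻¹ * x), mul_inv_rev, inv_inv]
  rw [h1]
  have hsub := integral_mul_left_eq_self (μ := S.μ) (fun h => f h * indK S K (x⁻¹ * h)) x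
  rw [← hsub]
  have h2 : (fun h => f (x * h) * indK S K (x⁻¹ * (x * h))) = fun h => f x * indK S K h := by
    funext h
    rw [inv_mul_cancel_left]
    by_cases hh : h ∈ K
    · rw [hf x h hh]
    · rw [S.indK_of_not_mem K hh, mul_zero, mul_zero]
  rw [h2, integral_const_mul, S.integral_indK K hKo hKc, mul_one]

end ConvInvariance

section Spherical

variable (hKo : IsOpen (K : Set G)) (hKc : IsCompact (K : Set G))

/-- **the spherical Hecke algebra** `C_c(K\G/K)` = the Hecke algebra of the trivial type (p3's `HeckeAlg` at
`σ = 1`; its ring and `ℂ`-algebra structures are p3's). -/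
abbrev SphericalHecke : Type :=
  HeckeAlg S K (trivialRep K) hKo hKc (continuous_trivialRep K) (isIrreducibleRep_trivialRep K)

variable [SecondCountableTopology G] [T2Space G] [MeasurableMul G] [SFinite S.μ]

omit [SecondCountableTopology G] [T2Space G] [SFinite S.μ] in
/-- **membership in the spherical Hecke algebra is bi-`K`-invariance** (`= C_c(K\G/K)`). -/
theorem mem_sphericalHecke_iff (t : G → ℂ) :
    t ∈ HeckeAlg S K (trivialRep K) hKo hKc (continuous_trivialRep K) (isIrreducibleRep_trivialRep K) ↔
      IsTest t ∧ (∀ k ∈ K, ∀ g, t (k * g) = t g) ∧ ∀ g, ∀ k ∈ K, t (g * k) = t g := by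
  rw [mem_heckeAlg, eσ_trivialRep]
  constructor
  · rintro ⟨ht, h1, h2⟩
    refine ⟨ht, fun k hk g => ?_, fun g k hk => ?_⟩
    · rw [← h1]
      exact S.conv_left_invariant K (S.indK_left_invariant K) k hk g
    · rw [← h2]
      exact S.conv_right_invariant K (S.indK_right_invariant K) g k hk
  · rintro ⟨ht, h1, h2⟩
    exact ⟨ht, S.conv_indK_left K hKo hKc h1, S.conv_indK_right K hKo hKc h2⟩

omit [SecondCountableTopology G] [T2Space G] [MeasurableMul G] [SFinite S.μ] in
/-- `htst`: an element of the spherical Hecke algebra is a test function. -/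
theorem sphericalHecke_isTest (r : SphericalHecke S K hKo hKc) : IsTest (r : G → ℂ) := r.2.1

omit [SecondCountableTopology G] [T2Space G] [SFinite S.μ] in
/-- an element of the spherical Hecke algebra is left-`K`-invariant. -/
theorem sphericalHecke_left_invariant (r : SphericalHecke S K hKo hKc) :
    ∀ k ∈ K, ∀ g, (r : G → ℂ) (k * g) = (r : G → ℂ) g :=
  ((S.mem_sphericalHecke_iff K hKo hKc r).1 r.2).2.1

omit [SecondCountableTopology G] [T2Space G] [SFinite S.μ] in
/-- `htstK`: an element of the spherical Hecke algebra is right-`K`-invariant. -/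
theorem sphericalHecke_right_invariant (r : SphericalHecke S K hKo hKc) :
    ∀ g, ∀ k ∈ K, (r : G → ℂ) (g * k) = (r : G → ℂ) g :=
  ((S.mem_sphericalHecke_iff K hKo hKc r).1 r.2).2.2

omit [IsTopologicalGroup G] [BorelSpace G] [SecondCountableTopology G] [T2Space G] [SFinite S.μ] in
/-- `R(f) ψ` lies in the spherical block for a left-`K`-invariant `f` and `ψ` in the block. -/
theorem R_mem_sphericalBlock {f : G → ℂ} (hf : ∀ k ∈ K, ∀ g, f (k * g) = f g) {ψ : G → ℂ}
    (hψ : ψ ∈ sphericalBlock S K) : S.R f ψ ∈ sphericalBlock S K :=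
  ⟨S.R_invariant f hψ.1, fun x _ hk => S.R_mul_right_of_left_invariant K hf ψ hk x⟩

/-- **the action of the spherical Hecke algebra on the spherical block**: `r • ψ := R (r) ψ`. -/
instance : Module (SphericalHecke S K hKo hKc) (sphericalBlock S K) where
  smul r ψ := ⟨S.R (r : G → ℂ) ψ,
    S.R_mem_sphericalBlock K (S.sphericalHecke_left_invariant K hKo hKc r) ψ.2⟩
  one_smul ψ := Subtype.ext (by
    show S.R (eσ S K (trivialRep K)) ψ = ψ
    rw [eσ_trivialRep]
    exact S.R_indK_of_right_invariant K hKo hKc ψ.2.2)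
  mul_smul r r' ψ := Subtype.ext
    (S.R_R_eq_R_conv r.2.1 r'.2.1 (S.continuous_of_mem_sphericalBlock K hKo ψ.2)).symm
  smul_zero _ := Subtype.ext (S.R_zero' _)
  smul_add r ψ ψ' := Subtype.ext
    (S.R_add' r.2.1 (S.continuous_of_mem_sphericalBlock K hKo ψ.2) (S.continuous_of_mem_sphericalBlock K hKo ψ'.2))
  add_smul r r' ψ := Subtype.ext (S.R_add_fun r.2.1 r'.2.1 (S.continuous_of_mem_sphericalBlock K hKo ψ.2))
  zero_smul _ := Subtype.ext (S.R_zero_fun _)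

/-- `hact`: the action IS the right-regular action of the underlying test function (`rfl`). -/
theorem smul_coe (r : SphericalHecke S K hKo hKc) (ψ : sphericalBlock S K) :
    ((r • ψ : sphericalBlock S K) : G → ℂ) = S.R (r : G → ℂ) ψ := rfl

/-- the scalars pass through the action. -/
instance : IsScalarTower ℂ (SphericalHecke S K hKo hKc) (sphericalBlock S K) :=
  ⟨fun c _ _ => Subtype.ext (S.R_smul_left _ _ c)⟩

/-- **`hfull` for the spherical Hecke algebra**: `R(indK) ∘ R(f)` on the block is the action of
`indK ⋆ f ⋆ indK ∈ C_c(K\G/K)` (BlockSimple's displayed clause, discharged). -/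
theorem hfull_spherical (f : G → ℂ) (hf : IsTest f) :
    ∃ r : SphericalHecke S K hKo hKc, ∀ ψ ∈ sphericalBlock S K,
      S.R (indK S K) (S.R f ψ) = S.R (r : G → ℂ) ψ := by
  refine ⟨⟨S.conv (S.conv (indK S K) f) (indK S K), ?_⟩, fun ψ hψ => ?_⟩
  · have h := S.heckeElt_mem K (trivialRep K) hKo hKc (continuous_trivialRep K) (isIrreducibleRep_trivialRep K) hf
    rwa [eσ_trivialRep] at h
  · exact S.R_R_eq_R_conv_conv (S.isTest_indK K hKo hKc) hf (S.continuous_of_mem_sphericalBlock K hKo hψ)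
      (S.R_indK_of_right_invariant K hKo hKc hψ.2)

end Spherical

section Consumers

variable (hKo : IsOpen (K : Set G)) (hKc : IsCompact (K : Set G))
  [SecondCountableTopology G] [T2Space G] [MeasurableMul G] [SFinite S.μ]

/-- **(C1) for the spherical Hecke algebra**: a constituent `Wi = τ m' ∩ sphericalBlock` of an invariant
irreducible `τ m'` with a non-zero vector is a simple `SphericalHecke S K hKo hKc`-module. -/
theorem isSimpleModule_spherical {τ : ℕ → Set (G → ℂ)} (m' : ℕ) (hinv : S.IsInvariantSubspace (τ m'))
    (hirr : S.IsIrreducible (τ m')) (Wi : Submodule (SphericalHecke S K hKo hKc) (sphericalBlock S K))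
    (hWi : ∀ ψ : sphericalBlock S K, ψ ∈ Wi ↔ (ψ : G → ℂ) ∈ τ m')
    (hne : ∃ w : sphericalBlock S K, w ∈ Wi ∧ w ≠ 0) : IsSimpleModule (SphericalHecke S K hKo hKc) Wi := by
  haveI : Countable S.Gk := S.countable_Gk
  haveI : FiniteDimensional ℂ (sphericalBlock S K) := S.finiteDimensional_sphericalBlock K hKo
  refine S.isSimpleModule_of_block m' hinv hirr (fun r : SphericalHecke S K hKo hKc => (r : G → ℂ))
    (S.smul_coe K hKo hKc) Wi hWi (S.R (indK S K)) ?_ ?_ ?_ ?_ ?_ ?_ hne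
  · intro ψ hψ φ hφ
    exact S.R_add' (S.isTest_indK K hKo hKc) (hinv.cont ψ hψ) (hinv.cont φ hφ)
  · intro ψ _ c
    exact S.R_smul' _ ψ c
  · intro ψ hψ φ hφ
    exact S.inner_R_indK_adj K hKo hKc (hinv.inv ψ hψ) (hinv.cont ψ hψ) (hinv.inv φ hφ) (hinv.cont φ hφ)
  · intro v hv
    exact S.R_indK_of_right_invariant K hKo hKc hv.2
  · exact S.hfull_spherical K hKo hKc
  · exact ⟨indK S K, S.isTest_indK K hKo hKc, fun v hv => S.R_indK_of_right_invariant K hKo hKc hv.2⟩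

/-- **(C2) for the spherical Hecke algebra**: the constituents `W i = τ (idx i) ∩ sphericalBlock` of a family of
invariant irreducible `τ` are pairwise non-isomorphic `SphericalHecke S K hKo hKc`-modules as soon as their
algebraic cores are pairwise non-isomorphic representations (multiplicity one of the cores, DISPLAYED). -/
theorem hnon_spherical_of_multiplicityOne_core [LocallyCompactSpace G] {ι : Type} {τ : ℕ → Set (G → ℂ)}
    (hinv : ∀ m, S.IsInvariantSubspace (τ m)) (hirr : ∀ m, S.IsIrreducible (τ m)) {idx : ι → ℕ}
    {W : ι → Submodule (SphericalHecke S K hKo hKc) (sphericalBlock S K)}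
    (hW : ∀ (i : ι) (ψ : sphericalBlock S K), ψ ∈ W i ↔ (ψ : G → ℂ) ∈ τ (idx i))
    (hM : ∀ i j : ι, i ≠ j → ¬ S.IsoRep (S.core (W i)) (S.core (W j))) :
    ∀ i j : ι, i ≠ j → IsEmpty ((W i) ≃ₗ[SphericalHecke S K hKo hKc] (W j)) :=
  S.hnon_of_multiplicityOne_core (S.isTest_indK K hKo hKc) (S.mem_sphericalBlock_iff_fixed K hKo hKc)
    (S.smul_coe K hKo hKc) (S.hfull_spherical K hKo hKc) hinv hirr hW hM

end Consumers

end Setting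

end RTF

end Summit.Ventures.HodgeRepro.Tier4.Line1

end
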